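import Summits.CriticalPhenomena.PercolationContinuityZ3.Theorems.PercNearOneGluingNoHeavyQuantThreeRootGenericCoupling
import HarnessLib

/-!
# QUANT lane R8, T-DEC: THE GENERIC THREE-TREE GATE STEP FROM THE OPENED FORESTS — the DEC consequence of the generic three-root
# gate-coupling identity (`…QuantThreeRootGenericCoupling`)

builds on p205010 (kernel theorem, internal audit signed; external expert review pending)

Support file (`--supports stmt-CriticalPhenomena-4575`), QUANT lane seat prim-quant-arm-1 (gen 46, architect); memo
`run/shared/lean/prim/quant/prim-quant-arm-1-g46/ARCH-LIGHT-G46.md` §2–§3.  Theorems only, standard axioms, no sorries.  The width-3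
analogue of arm-1 g45's `decAt_twoRoot_of_opened` / `sdec_twoRoot_of_opened` (`…QuantTwoRootGateCoupling`).

THE STEP (`decAt_threeRootGeneric_of_opened`).  Opened trees `ρ₁, ρ₂, ρ₃` (top-affordable probability laws on `{0..Mᵢ}`, SDEC at floors
`yᵢ ∈ (0,1)`, means `Sᵢ > 0`), root gates `0 < q₂ ≤ q₁ < 1` (the PAIR, hub 1) and `0 < q₃ ≤ Q := q₁ + q₂ − q₁q₂`, `q₃ < 1` (the SINGLE),
re-gates `λ₂ = q₂(S₂ − (1−q₁)S₁)/(Q S₂)`, `λ₁ = q₁(S₁ − (1−q₂)S₂)/(Q S₁)` (nonnegative: `(1−q₁)S₁ ≤ S₂`, `(1−q₂)S₂ ≤ S₁`), and the THREE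
SMALLER FORESTS of the identity SDEC at some floors: the opened pair `ρ₁ ⊔ gate_{q₂/q₁}ρ₂` at `w₁₂` (and top-affordable there), the opened
hubs `G₁ = ρ₁ ⊔ gate_{λ₂}ρ₂ ⊔ gate_{q₃/Q}ρ₃` at `v₁`, `G₂ = gate_{λ₁}ρ₁ ⊔ ρ₂ ⊔ gate_{q₃/Q}ρ₃` at `v₂`; an outer gate `0 < a ≤ 1`; a floor
`0 < z ≤ a qᵢ yᵢ` (i = 1,2,3), `z ≤ a q₁ w₁₂`, `z ≤ aQ v₁`, `z ≤ aQ v₂`.  THEN `gate_a(gate_{q₁}ρ₁ ∗ gate_{q₂}ρ₂ ∗ gate_{q₃}ρ₃)` is DEC(j) at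
floor `z` at every layer `j < M₁ + M₂ + M₃`: the four components of the identity are DEC at the common target `a(q₁S₁ + q₂S₂ + q₃S₃)` —
`P` and `C` by `convClosedT_holds` (census-2 g60) from the gated opened trees / the gated opened pair, `U₁`, `U₂` as gated SDEC forests —
and `decAtT_mixture` closes.  `sdec_threeRootGeneric_of_opened` is the SDEC form (all outer gates).  Inside `LawDec.GateStepN` (lead g42)
all seven SDEC hypotheses are ORACLE instances (each forest has at most `n₁+n₂+n₃+2` nontrivial gates, one fewer than the three-tree
forest); the floor side conditions say: the single may carry the forest floor, the two pair boxes need the slack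
`q₂y₂(1 − (1−q₁)S₁/S₂) ≥ x_F`, `q₁y₁(1 − (1−q₂)S₂/S₁) ≥ x_F` (with `vᵢ` the true floors of `Gᵢ`).

HONEST STATUS.  `GateStepN`, `GateStepNCore`, `FarTreeRow` remain OPEN; RATE class (log\*) and the honest sentence of
`run/shared/lean/prim/quant/README.md` unchanged.  [this work]; `convClosedT_holds`: census-2 g60; two-root template: arm-1 g45 (this lane).
Nothing here is a published result.  The gluing rows served [cite: KozmaNitzan2024, Conjecture 3 (p. 15)]; product measure [cite: Grimmett1999, §1.3 p. 10].
-/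

noncomputable section

namespace Summit.CriticalPhenomena.PercolationContinuityZ3.Theorems

namespace Quant

open Finset

namespace LawDec

/-! ### Two bookkeeping lemmas: DEC at every layer -/

/-- **all layers from the layers below the top**: a top-affordable probability law on `{0..M}` at floor `0 ≤ x < 1` that is DEC(j) at its
mean for every `j < M` is DEC(j) at its mean for EVERY `j` (layers `≥ M` by Theorem A, `decAt_of_top_le`). [this work] -/
theorem decAtT_all_of_below (M : ℕ) (μ : ℕ → ℝ) (x : ℝ) (hx0 : 0 ≤ x) (hx1 : x < 1)
    (hμ0 : ∀ h, 0 ≤ μ h) (hμM : ∀ h, M < h → μ h = 0) (hμ1 : ∑ h ∈ Finset.range (M + 1), μ h = 1)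
    (hta : x * (M : ℝ) ≤ ∑ h ∈ Finset.range (M + 1), (h : ℝ) * μ h)
    (hbelow : ∀ j, j < M → DECAtT x (∑ h ∈ Finset.range (M + 1), (h : ℝ) * μ h) j M μ) (j : ℕ) :
    DECAtT x (∑ h ∈ Finset.range (M + 1), (h : ℝ) * μ h) j M μ := by
  by_cases hj : j < M
  · exact hbelow j hj
  · rw [← decAt_iff_decAtT]
    refine decAt_of_top_le M μ hμ0 hμM hμ1 x hx1 (fun k hk => ?_) j (not_lt.1 hj)
    have hkM : k ≤ M := by
      by_contra hlt
      exact absurd (hμM k (not_le.1 hlt)) (ne_of_gt hk)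
    have : x * (k : ℝ) ≤ x * (M : ℝ) := mul_le_mul_of_nonneg_left (by exact_mod_cast hkM) hx0
    linarith

/-- **a gated SDEC law is DEC at every layer** at every floor `z ≤ q·y` (target `q·mean`): below the top by SDEC, at and above it by
Theorem A (`decAt_gate_of_top_le`). [this work] -/
theorem decAtT_gate_of_sdec (M : ℕ) (ρ : ℕ → ℝ) (y q z : ℝ) (hy0 : 0 ≤ y) (hq0 : 0 < q) (hq1 : q ≤ 1) (hqy1 : q * y < 1) (hz : z ≤ q * y)
    (h0 : ∀ h, 0 ≤ ρ h) (hM : ∀ h, M < h → ρ h = 0) (h1 : ∑ h ∈ Finset.range (M + 1), ρ h = 1)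
    (hta : y * (M : ℝ) ≤ ∑ h ∈ Finset.range (M + 1), (h : ℝ) * ρ h) (hS : SDEC y M ρ) (j : ℕ) :
    DECAtT z (q * ∑ h ∈ Finset.range (M + 1), (h : ℝ) * ρ h) j M (gate ρ q) := by
  have d : DECAt (q * y) j M (gate ρ q) := by
    by_cases hjM : j < M
    · exact hS q hq0 hq1 j hjM
    · exact decAt_gate_of_top_le M ρ y q hy0 hqy1 hq0.le hq1 h0 hM h1 hta j (not_lt.1 hjM)
  have d' := decAt_mono_floor hz hqy1 d
  rwa [decAt_iff_decAtT, sum_mul_gate] at d'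

/-! ### The generic three-tree gate step -/

/-- `a·b < 1` for `a ≤ 1`, `0 ≤ b < 1` (bookkeeping). [this work] -/
theorem mul_lt_one_aux {a b : ℝ} (ha1 : a ≤ 1) (hb0 : 0 ≤ b) (hb1 : b < 1) : a * b < 1 := by
  have : a * b ≤ 1 * b := mul_le_mul_of_nonneg_right ha1 hb0
  linarith

/-- **THE GENERIC THREE-TREE GATE STEP FROM THE OPENED FORESTS** (see the module docstring).  The means `Rᵢ`, the compound gate `Q` and
the re-gates `l₁, l₂` are passed as parameters with their defining equations. [this work] -/
theorem decAt_threeRootGeneric_of_opened (y₁ y₂ y₃ w₁₂ v₁ v₂ z q₁ q₂ q₃ a Q R₁ R₂ R₃ l₁ l₂ : ℝ) (M₁ M₂ M₃ : ℕ) (ρ₁ ρ₂ ρ₃ : ℕ → ℝ)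
    (hy₁0 : 0 < y₁) (hy₁1 : y₁ < 1) (hy₂0 : 0 < y₂) (hy₂1 : y₂ < 1) (hy₃0 : 0 < y₃) (hy₃1 : y₃ < 1)
    (hw0 : 0 ≤ w₁₂) (hw1 : w₁₂ < 1) (hv₁0 : 0 ≤ v₁) (hv₁1 : v₁ < 1) (hv₂0 : 0 ≤ v₂) (hv₂1 : v₂ < 1)
    (hq₂0 : 0 < q₂) (hq₂₁ : q₂ ≤ q₁) (hq₁1 : q₁ < 1) (hq₃0 : 0 < q₃) (hq₃1 : q₃ < 1)
    (hQ : Q = q₁ + q₂ - q₁ * q₂) (hq₃Q : q₃ ≤ Q) (ha0 : 0 < a) (ha1 : a ≤ 1) (hz0 : 0 < z)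
    (h₁0 : ∀ h, 0 ≤ ρ₁ h) (h₁M : ∀ h, M₁ < h → ρ₁ h = 0) (h₁1 : ∑ h ∈ Finset.range (M₁ + 1), ρ₁ h = 1)
    (hR₁ : ∑ h ∈ Finset.range (M₁ + 1), (h : ℝ) * ρ₁ h = R₁) (hta₁ : y₁ * (M₁ : ℝ) ≤ R₁) (hR₁0 : 0 < R₁)
    (h₂0 : ∀ h, 0 ≤ ρ₂ h) (h₂M : ∀ h, M₂ < h → ρ₂ h = 0) (h₂1 : ∑ h ∈ Finset.range (M₂ + 1), ρ₂ h = 1)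
    (hR₂ : ∑ h ∈ Finset.range (M₂ + 1), (h : ℝ) * ρ₂ h = R₂) (hta₂ : y₂ * (M₂ : ℝ) ≤ R₂) (hR₂0 : 0 < R₂)
    (h₃0 : ∀ h, 0 ≤ ρ₃ h) (h₃M : ∀ h, M₃ < h → ρ₃ h = 0) (h₃1 : ∑ h ∈ Finset.range (M₃ + 1), ρ₃ h = 1)
    (hR₃ : ∑ h ∈ Finset.range (M₃ + 1), (h : ℝ) * ρ₃ h = R₃) (hta₃ : y₃ * (M₃ : ℝ) ≤ R₃)
    (hD₁ : SDEC y₁ M₁ ρ₁) (hD₂ : SDEC y₂ M₂ ρ₂) (hD₃ : SDEC y₃ M₃ ρ₃)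
    -- the re-gates and their range
    (hl₂ : l₂ = q₂ * (R₂ - (1 - q₁) * R₁) / (Q * R₂)) (hl₁ : l₁ = q₁ * (R₁ - (1 - q₂) * R₂) / (Q * R₁))
    (hl₂R : (1 - q₁) * R₁ ≤ R₂) (hl₁R : (1 - q₂) * R₂ ≤ R₁)
    -- the three smaller forests (oracle instances in `GateStepN`)
    (hG₁₂ : SDEC w₁₂ (M₁ + M₂) (lconv M₁ M₂ ρ₁ (gate ρ₂ (q₂ / q₁))))
    (htaG₁₂ : w₁₂ * ((M₁ + M₂ : ℕ) : ℝ) ≤ R₁ + q₂ / q₁ * R₂)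
    (hG₁ : SDEC v₁ (M₁ + M₂ + M₃) (lconv (M₁ + M₂) M₃ (lconv M₁ M₂ ρ₁ (gate ρ₂ l₂)) (gate ρ₃ (q₃ / Q))))
    (hG₂ : SDEC v₂ (M₁ + M₂ + M₃) (lconv (M₁ + M₂) M₃ (lconv M₁ M₂ (gate ρ₁ l₁) ρ₂) (gate ρ₃ (q₃ / Q))))
    (hz₁ : z ≤ a * q₁ * y₁) (hz₂ : z ≤ a * q₂ * y₂) (hz₃ : z ≤ a * q₃ * y₃) (hz₁₂ : z ≤ a * q₁ * w₁₂)
    (hzv₁ : z ≤ a * Q * v₁) (hzv₂ : z ≤ a * Q * v₂)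
    (j : ℕ) (hj : j < M₁ + M₂ + M₃) :
    DECAt z j (M₁ + M₂ + M₃) (gate (lconv (M₁ + M₂) M₃ (lconv M₁ M₂ (gate ρ₁ q₁) (gate ρ₂ q₂)) (gate ρ₃ q₃)) a) := by
  -- elementary bounds
  have hq₁0 : 0 < q₁ := lt_of_lt_of_le hq₂0 hq₂₁
  have hq₂1 : q₂ < 1 := lt_of_le_of_lt hq₂₁ hq₁1
  have hQq₁ : q₁ ≤ Q := by
    have t : 0 ≤ q₂ * (1 - q₁) := mul_nonneg hq₂0.le (by linarith)
    have e : Q - q₁ = q₂ * (1 - q₁) := by rw [hQ]; ring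
    linarith
  have hQq₂ : q₂ ≤ Q := by
    have t : 0 ≤ q₁ * (1 - q₂) := mul_nonneg hq₁0.le (by linarith)
    have e : Q - q₂ = q₁ * (1 - q₂) := by rw [hQ]; ring
    linarith
  have hQ1 : Q < 1 := by
    have t : 0 < (1 - q₁) * (1 - q₂) := mul_pos (by linarith) (by linarith)
    have e : 1 - Q = (1 - q₁) * (1 - q₂) := by rw [hQ]; ring
    linarith
  have hQ0 : 0 < Q := lt_of_lt_of_le hq₁0 hQq₁
  have haq₁0 : 0 < a * q₁ := mul_pos ha0 hq₁0
  have haq₁1 : a * q₁ < 1 := mul_lt_one_aux ha1 hq₁0.le hq₁1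
  have haq₂0 : 0 < a * q₂ := mul_pos ha0 hq₂0
  have haq₂1 : a * q₂ < 1 := mul_lt_one_aux ha1 hq₂0.le hq₂1
  have haq₃0 : 0 < a * q₃ := mul_pos ha0 hq₃0
  have haq₃1 : a * q₃ < 1 := mul_lt_one_aux ha1 hq₃0.le hq₃1
  have haQ0 : 0 < a * Q := mul_pos ha0 hQ0
  have haQ1 : a * Q < 1 := mul_lt_one_aux ha1 hQ0.le hQ1
  have hr0 : 0 < q₂ / q₁ := div_pos hq₂0 hq₁0
  have hr1 : q₂ / q₁ ≤ 1 := by rw [div_le_one hq₁0]; exact hq₂₁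
  have hc₃0 : 0 < q₃ / Q := div_pos hq₃0 hQ0
  have hc₃1 : q₃ / Q ≤ 1 := by rw [div_le_one hQ0]; exact hq₃Q
  have hz1 : z < 1 := lt_of_le_of_lt hz₁ (mul_lt_one_aux haq₁1.le hy₁0.le hy₁1)
  have hl₂0 : 0 ≤ l₂ := by
    rw [hl₂]; exact div_nonneg (mul_nonneg hq₂0.le (by linarith)) (mul_pos hQ0 hR₂0).le
  have hl₂1 : l₂ ≤ 1 := by
    rw [hl₂, div_le_one (mul_pos hQ0 hR₂0)]
    have t1 : q₂ * R₂ ≤ Q * R₂ := mul_le_mul_of_nonneg_right hQq₂ hR₂0.le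
    have t2 : 0 ≤ q₂ * ((1 - q₁) * R₁) := mul_nonneg hq₂0.le (mul_nonneg (by linarith) hR₁0.le)
    have e : q₂ * (R₂ - (1 - q₁) * R₁) = q₂ * R₂ - q₂ * ((1 - q₁) * R₁) := by ring
    linarith
  have hl₁0 : 0 ≤ l₁ := by
    rw [hl₁]; exact div_nonneg (mul_nonneg hq₁0.le (by linarith)) (mul_pos hQ0 hR₁0).le
  have hl₁1 : l₁ ≤ 1 := by
    rw [hl₁, div_le_one (mul_pos hQ0 hR₁0)]
    have t1 : q₁ * R₁ ≤ Q * R₁ := mul_le_mul_of_nonneg_right hQq₁ hR₁0.le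
    have t2 : 0 ≤ q₁ * ((1 - q₂) * R₂) := mul_nonneg hq₁0.le (mul_nonneg (by linarith) hR₂0.le)
    have e : q₁ * (R₁ - (1 - q₂) * R₂) = q₁ * R₁ - q₁ * ((1 - q₂) * R₂) := by ring
    linarith
  -- weights
  obtain ⟨w, hwdef⟩ : ∃ w : ℝ, w = (1 - Q) / (1 - a * Q) := ⟨_, rfl⟩
  obtain ⟨w₁₂', hw₁₂def⟩ : ∃ w' : ℝ, w' = (1 - q₁) / (1 - a * q₁) := ⟨_, rfl⟩
  obtain ⟨D, hDdef⟩ : ∃ D : ℝ, D = q₁ * (1 - q₂) * R₂ + q₂ * (1 - q₁) * R₁ := ⟨_, rfl⟩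
  obtain ⟨x₁, hx₁def⟩ : ∃ x : ℝ, x = q₁ * (1 - q₂) * R₂ / D := ⟨_, rfl⟩
  have hD0 : 0 < D := by
    rw [hDdef]
    have t1 : 0 < q₁ * (1 - q₂) * R₂ := mul_pos (mul_pos hq₁0 (by linarith)) hR₂0
    have t2 : 0 < q₂ * (1 - q₁) * R₁ := mul_pos (mul_pos hq₂0 (by linarith)) hR₁0
    linarith
  have hw0' : 0 ≤ w := by rw [hwdef]; exact div_nonneg (by linarith) (by linarith)
  have hw1' : w ≤ 1 := by
    rw [hwdef, div_le_one (by linarith)]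
    have : a * Q ≤ 1 * Q := mul_le_mul_of_nonneg_right ha1 hQ0.le
    linarith
  have hw₁₂0 : 0 ≤ w₁₂' := by rw [hw₁₂def]; exact div_nonneg (by linarith) (by linarith)
  have hw₁₂1 : w₁₂' ≤ 1 := by
    rw [hw₁₂def, div_le_one (by linarith)]
    have : a * q₁ ≤ 1 * q₁ := mul_le_mul_of_nonneg_right ha1 hq₁0.le
    linarith
  have hx₁0 : 0 ≤ x₁ := by
    rw [hx₁def]; exact div_nonneg (mul_pos (mul_pos hq₁0 (by linarith)) hR₂0).le hD0.le
  have hx₁1 : x₁ ≤ 1 := by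
    rw [hx₁def, div_le_one hD0, hDdef]
    have : 0 ≤ q₂ * (1 - q₁) * R₁ := (mul_pos (mul_pos hq₂0 (by linarith)) hR₁0).le
    linarith
  -- laws of the gated boxes
  obtain ⟨g₁0, g₁M, g₁1⟩ := gate_laws M₁ ρ₁ (a * q₁) haq₁0.le haq₁1.le h₁0 h₁M h₁1
  obtain ⟨g₂0, g₂M, g₂1⟩ := gate_laws M₂ ρ₂ (a * q₂) haq₂0.le haq₂1.le h₂0 h₂M h₂1
  obtain ⟨g₃0, g₃M, g₃1⟩ := gate_laws M₃ ρ₃ (a * q₃) haq₃0.le haq₃1.le h₃0 h₃M h₃1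
  -- every gated box is DEC at every layer (floor z)
  have d₁ : ∀ j'', DECAtT z (a * q₁ * R₁) j'' M₁ (gate ρ₁ (a * q₁)) := by
    intro j''
    have := decAtT_gate_of_sdec M₁ ρ₁ y₁ (a * q₁) z hy₁0.le haq₁0 haq₁1.le (mul_lt_one_aux haq₁1.le hy₁0.le hy₁1)
      hz₁ h₁0 h₁M h₁1 (by rw [hR₁]; exact hta₁) hD₁ j''
    rwa [hR₁] at this
  have d₂ : ∀ j'', DECAtT z (a * q₂ * R₂) j'' M₂ (gate ρ₂ (a * q₂)) := by
    intro j''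
    have := decAtT_gate_of_sdec M₂ ρ₂ y₂ (a * q₂) z hy₂0.le haq₂0 haq₂1.le (mul_lt_one_aux haq₂1.le hy₂0.le hy₂1)
      hz₂ h₂0 h₂M h₂1 (by rw [hR₂]; exact hta₂) hD₂ j''
    rwa [hR₂] at this
  have d₃ : ∀ j'', DECAtT z (a * q₃ * R₃) j'' M₃ (gate ρ₃ (a * q₃)) := by
    intro j''
    have := decAtT_gate_of_sdec M₃ ρ₃ y₃ (a * q₃) z hy₃0.le haq₃0 haq₃1.le (mul_lt_one_aux haq₃1.le hy₃0.le hy₃1)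
      hz₃ h₃0 h₃M h₃1 (by rw [hR₃]; exact hta₃) hD₃ j''
    rwa [hR₃] at this
  -- component P: the product of the three scaled boxes — ConvClosedT twice
  have hP : DECAtT z (a * (q₁ * R₁ + q₂ * R₂ + q₃ * R₃)) j (M₁ + M₂ + M₃)
      (lconv (M₁ + M₂) M₃ (lconv M₁ M₂ (gate ρ₁ (a * q₁)) (gate ρ₂ (a * q₂))) (gate ρ₃ (a * q₃))) := by
    have p0 : ∀ h, 0 ≤ lconv M₁ M₂ (gate ρ₁ (a * q₁)) (gate ρ₂ (a * q₂)) h := lconv_nonneg _ _ _ _ g₁0 g₂0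
    have pM : ∀ h, M₁ + M₂ < h → lconv M₁ M₂ (gate ρ₁ (a * q₁)) (gate ρ₂ (a * q₂)) h = 0 :=
      fun h hh => lconv_eq_zero _ _ _ _ h hh
    have p1 := sum_lconv M₁ M₂ _ _ g₁1 g₂1
    have pmean : ∑ h ∈ Finset.range (M₁ + M₂ + 1), (h : ℝ) * lconv M₁ M₂ (gate ρ₁ (a * q₁)) (gate ρ₂ (a * q₂)) h
        = a * q₁ * R₁ + a * q₂ * R₂ := by
      rw [sum_mul_lconv M₁ M₂ _ _ g₁1 g₂1, sum_mul_gate, sum_mul_gate, hR₁, hR₂]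
    have pta : z * ((M₁ + M₂ : ℕ) : ℝ) ≤ a * q₁ * R₁ + a * q₂ * R₂ := by
      have e1 := mul_le_mul_of_nonneg_right hz₁ (Nat.cast_nonneg M₁)
      have e1' := mul_le_mul_of_nonneg_left hta₁ haq₁0.le
      have e2 := mul_le_mul_of_nonneg_right hz₂ (Nat.cast_nonneg M₂)
      have e2' := mul_le_mul_of_nonneg_left hta₂ haq₂0.le
      have ee1 : a * q₁ * y₁ * (M₁ : ℝ) = a * q₁ * (y₁ * (M₁ : ℝ)) := by ring
      have ee2 : a * q₂ * y₂ * (M₂ : ℝ) = a * q₂ * (y₂ * (M₂ : ℝ)) := by ring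
      push_cast
      linarith
    have pair : ∀ j'', DECAtT z (a * q₁ * R₁ + a * q₂ * R₂) j'' (M₁ + M₂)
        (lconv M₁ M₂ (gate ρ₁ (a * q₁)) (gate ρ₂ (a * q₂))) := by
      have below : ∀ j'', j'' < M₁ + M₂ → DECAtT z (a * q₁ * R₁ + a * q₂ * R₂) j'' (M₁ + M₂)
          (lconv M₁ M₂ (gate ρ₁ (a * q₁)) (gate ρ₂ (a * q₂))) := fun j'' hj'' =>
        convClosedT_holds z (a * q₁ * R₁) (a * q₂ * R₂) M₁ M₂ j'' _ _ hz0 hz1 g₁0 g₁M g₁1 g₂0 g₂M g₂1 hj''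
          (fun k _ _ => d₁ k) (fun k _ _ => d₂ k)
      intro j''
      have := decAtT_all_of_below (M₁ + M₂) _ z hz0.le hz1 p0 pM p1 (by rw [pmean]; exact pta)
        (by rw [pmean]; exact below) j''
      rwa [pmean] at this
    have hC := convClosedT_holds z (a * q₁ * R₁ + a * q₂ * R₂) (a * q₃ * R₃) (M₁ + M₂) M₃ j _ _ hz0 hz1 p0 pM p1 g₃0 g₃M g₃1
      hj (fun k _ _ => pair k) (fun k _ _ => d₃ k)
    have e : a * q₁ * R₁ + a * q₂ * R₂ + a * q₃ * R₃ = a * (q₁ * R₁ + q₂ * R₂ + q₃ * R₃) := by ring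
    rwa [e] at hC
  -- component C: the gated opened pair beside the scaled single — oracle `hG₁₂` + ConvClosedT
  have hCc : DECAtT z (a * (q₁ * R₁ + q₂ * R₂ + q₃ * R₃)) j (M₁ + M₂ + M₃)
      (lconv (M₁ + M₂) M₃ (gate (lconv M₁ M₂ ρ₁ (gate ρ₂ (q₂ / q₁))) (a * q₁)) (gate ρ₃ (a * q₃))) := by
    obtain ⟨r0, rM, r1⟩ := gate_laws M₂ ρ₂ (q₂ / q₁) hr0.le hr1 h₂0 h₂M h₂1
    have o0 : ∀ h, 0 ≤ lconv M₁ M₂ ρ₁ (gate ρ₂ (q₂ / q₁)) h := lconv_nonneg _ _ _ _ h₁0 r0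
    have oM : ∀ h, M₁ + M₂ < h → lconv M₁ M₂ ρ₁ (gate ρ₂ (q₂ / q₁)) h = 0 := fun h hh => lconv_eq_zero _ _ _ _ h hh
    have o1 := sum_lconv M₁ M₂ _ _ h₁1 r1
    have omean : ∑ h ∈ Finset.range (M₁ + M₂ + 1), (h : ℝ) * lconv M₁ M₂ ρ₁ (gate ρ₂ (q₂ / q₁)) h = R₁ + q₂ / q₁ * R₂ := by
      rw [sum_mul_lconv M₁ M₂ _ _ h₁1 r1, sum_mul_gate, hR₁, hR₂]
    have dG : ∀ j'', DECAtT z (a * q₁ * (R₁ + q₂ / q₁ * R₂)) j'' (M₁ + M₂)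
        (gate (lconv M₁ M₂ ρ₁ (gate ρ₂ (q₂ / q₁))) (a * q₁)) := by
      intro j''
      have := decAtT_gate_of_sdec (M₁ + M₂) _ w₁₂ (a * q₁) z hw0 haq₁0 haq₁1.le (mul_lt_one_aux haq₁1.le hw0 hw1)
        hz₁₂ o0 oM o1 (by rw [omean]; exact htaG₁₂) hG₁₂ j''
      rwa [omean] at this
    obtain ⟨c0, cM, c1⟩ := gate_laws (M₁ + M₂) _ (a * q₁) haq₁0.le haq₁1.le o0 oM o1
    have hC := convClosedT_holds z (a * q₁ * (R₁ + q₂ / q₁ * R₂)) (a * q₃ * R₃) (M₁ + M₂) M₃ j _ _ hz0 hz1 c0 cM c1 g₃0 g₃M g₃1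
      hj (fun k _ _ => dG k) (fun k _ _ => d₃ k)
    have e : a * q₁ * (R₁ + q₂ / q₁ * R₂) + a * q₃ * R₃ = a * (q₁ * R₁ + q₂ * R₂ + q₃ * R₃) := by
      field_simp
    rwa [e] at hC
  -- components U₁, U₂: gated SDEC forests (oracles `hG₁`, `hG₂`)
  obtain ⟨m₂0, m₂M, m₂1⟩ := gate_laws M₂ ρ₂ l₂ hl₂0 hl₂1 h₂0 h₂M h₂1
  obtain ⟨m₁0, m₁M, m₁1⟩ := gate_laws M₁ ρ₁ l₁ hl₁0 hl₁1 h₁0 h₁M h₁1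
  obtain ⟨m₃0, m₃M, m₃1⟩ := gate_laws M₃ ρ₃ (q₃ / Q) hc₃0.le hc₃1 h₃0 h₃M h₃1
  have hU₁ : DECAtT z (a * (q₁ * R₁ + q₂ * R₂ + q₃ * R₃)) j (M₁ + M₂ + M₃)
      (gate (lconv (M₁ + M₂) M₃ (lconv M₁ M₂ ρ₁ (gate ρ₂ l₂)) (gate ρ₃ (q₃ / Q))) (a * Q)) := by
    have d := hG₁ (a * Q) haQ0 haQ1.le j hj
    have d' := decAt_mono_floor hzv₁ (mul_lt_one_aux haQ1.le hv₁0 hv₁1) d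
    have i1 := sum_lconv M₁ M₂ _ _ h₁1 m₂1
    rw [decAt_iff_decAtT, sum_mul_gate, sum_mul_lconv (M₁ + M₂) M₃ _ _ i1 m₃1, sum_mul_lconv M₁ M₂ _ _ h₁1 m₂1,
      sum_mul_gate, sum_mul_gate, hR₁, hR₂, hR₃] at d'
    have e : a * Q * (R₁ + l₂ * R₂ + q₃ / Q * R₃) = a * (q₁ * R₁ + q₂ * R₂ + q₃ * R₃) := by
      rw [hl₂]; field_simp; rw [hQ]; ring
    rwa [e] at d'
  have hU₂ : DECAtT z (a * (q₁ * R₁ + q₂ * R₂ + q₃ * R₃)) j (M₁ + M₂ + M₃)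
      (gate (lconv (M₁ + M₂) M₃ (lconv M₁ M₂ (gate ρ₁ l₁) ρ₂) (gate ρ₃ (q₃ / Q))) (a * Q)) := by
    have d := hG₂ (a * Q) haQ0 haQ1.le j hj
    have d' := decAt_mono_floor hzv₂ (mul_lt_one_aux haQ1.le hv₂0 hv₂1) d
    have i1 := sum_lconv M₁ M₂ _ _ m₁1 h₂1
    rw [decAt_iff_decAtT, sum_mul_gate, sum_mul_lconv (M₁ + M₂) M₃ _ _ i1 m₃1, sum_mul_lconv M₁ M₂ _ _ m₁1 h₂1,
      sum_mul_gate, sum_mul_gate, hR₁, hR₂, hR₃] at d'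
    have e : a * Q * (l₁ * R₁ + R₂ + q₃ / Q * R₃) = a * (q₁ * R₁ + q₂ * R₂ + q₃ * R₃) := by
      rw [hl₁]; field_simp; rw [hQ]; ring
    rwa [e] at d'
  -- the mixture
  have inner₁ := decAtT_mixture w₁₂' hw₁₂0 hw₁₂1 hP hCc
  have inner₂ := decAtT_mixture x₁ hx₁0 hx₁1 hU₁ hU₂
  have mix := decAtT_mixture w hw0' hw1' inner₁ inner₂
  -- the identity
  have e : gate (lconv (M₁ + M₂) M₃ (lconv M₁ M₂ (gate ρ₁ q₁) (gate ρ₂ q₂)) (gate ρ₃ q₃)) a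
      = fun h => w * (w₁₂' * lconv (M₁ + M₂) M₃ (lconv M₁ M₂ (gate ρ₁ (a * q₁)) (gate ρ₂ (a * q₂))) (gate ρ₃ (a * q₃)) h
            + (1 - w₁₂') * lconv (M₁ + M₂) M₃ (gate (lconv M₁ M₂ ρ₁ (gate ρ₂ (q₂ / q₁))) (a * q₁)) (gate ρ₃ (a * q₃)) h)
          + (1 - w) * (x₁ * gate (lconv (M₁ + M₂) M₃ (lconv M₁ M₂ ρ₁ (gate ρ₂ l₂)) (gate ρ₃ (q₃ / Q))) (a * Q) h
            + (1 - x₁) * gate (lconv (M₁ + M₂) M₃ (lconv M₁ M₂ (gate ρ₁ l₁) ρ₂) (gate ρ₃ (q₃ / Q))) (a * Q) h) := by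
    funext h
    have ex₂ : 1 - x₁ = q₂ * (1 - q₁) * R₁ / D := by
      rw [hx₁def]; field_simp; rw [hDdef]; ring
    rw [ex₂, hx₁def, hwdef, hw₁₂def, hl₂, hl₁, hDdef, hQ,
      threeRoot_gateCoupling_generic M₁ M₂ M₃ ρ₁ ρ₂ ρ₃ q₁ q₂ q₃ a R₁ R₂ h₁M h₂M h₃M hq₁0.ne'
        (by rw [← hQ]; exact hQ0.ne') (by rw [← hQ]; exact (sub_pos.2 haQ1).ne') (sub_pos.2 haq₁1).ne'
        hR₁0.ne' hR₂0.ne' (by rw [← hDdef]; exact hD0.ne') h]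
    ring
  -- the mean of the doubly gated three-tree law
  obtain ⟨t₁0, t₁M, t₁1⟩ := gate_laws M₁ ρ₁ q₁ hq₁0.le hq₁1.le h₁0 h₁M h₁1
  obtain ⟨t₂0, t₂M, t₂1⟩ := gate_laws M₂ ρ₂ q₂ hq₂0.le hq₂1.le h₂0 h₂M h₂1
  obtain ⟨t₃0, t₃M, t₃1⟩ := gate_laws M₃ ρ₃ q₃ hq₃0.le hq₃1.le h₃0 h₃M h₃1
  have hEmean : ∑ h ∈ Finset.range (M₁ + M₂ + M₃ + 1), (h : ℝ) *
      gate (lconv (M₁ + M₂) M₃ (lconv M₁ M₂ (gate ρ₁ q₁) (gate ρ₂ q₂)) (gate ρ₃ q₃)) a h = a * (q₁ * R₁ + q₂ * R₂ + q₃ * R₃) := by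
    rw [sum_mul_gate, sum_mul_lconv (M₁ + M₂) M₃ _ _ (sum_lconv M₁ M₂ _ _ t₁1 t₂1) t₃1, sum_mul_lconv M₁ M₂ _ _ t₁1 t₂1,
      sum_mul_gate, sum_mul_gate, sum_mul_gate, hR₁, hR₂, hR₃]
  rw [decAt_iff_decAtT, hEmean, e]
  exact mix


/-- **COROLLARY (SDEC form).**  Same data; conclusion: the three-tree forest `gate_{q₁}ρ₁ ∗ gate_{q₂}ρ₂ ∗ gate_{q₃}ρ₃` is SDEC at every floor
`0 < x` with `x ≤ qᵢyᵢ` (i = 1,2,3), `x ≤ q₁w₁₂`, `x ≤ Q v₁`, `x ≤ Q v₂` — at the forest's TRUE floor when `w₁₂, v₁, v₂` are the true floors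
of the three smaller forests and the two pair boxes have the slack of the module docstring. [this work] -/
theorem sdec_threeRootGeneric_of_opened (y₁ y₂ y₃ w₁₂ v₁ v₂ x q₁ q₂ q₃ Q R₁ R₂ R₃ l₁ l₂ : ℝ) (M₁ M₂ M₃ : ℕ) (ρ₁ ρ₂ ρ₃ : ℕ → ℝ)
    (hy₁0 : 0 < y₁) (hy₁1 : y₁ < 1) (hy₂0 : 0 < y₂) (hy₂1 : y₂ < 1) (hy₃0 : 0 < y₃) (hy₃1 : y₃ < 1)
    (hw0 : 0 ≤ w₁₂) (hw1 : w₁₂ < 1) (hv₁0 : 0 ≤ v₁) (hv₁1 : v₁ < 1) (hv₂0 : 0 ≤ v₂) (hv₂1 : v₂ < 1)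
    (hq₂0 : 0 < q₂) (hq₂₁ : q₂ ≤ q₁) (hq₁1 : q₁ < 1) (hq₃0 : 0 < q₃) (hq₃1 : q₃ < 1)
    (hQ : Q = q₁ + q₂ - q₁ * q₂) (hq₃Q : q₃ ≤ Q) (hx0 : 0 < x)
    (h₁0 : ∀ h, 0 ≤ ρ₁ h) (h₁M : ∀ h, M₁ < h → ρ₁ h = 0) (h₁1 : ∑ h ∈ Finset.range (M₁ + 1), ρ₁ h = 1)
    (hR₁ : ∑ h ∈ Finset.range (M₁ + 1), (h : ℝ) * ρ₁ h = R₁) (hta₁ : y₁ * (M₁ : ℝ) ≤ R₁) (hR₁0 : 0 < R₁)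
    (h₂0 : ∀ h, 0 ≤ ρ₂ h) (h₂M : ∀ h, M₂ < h → ρ₂ h = 0) (h₂1 : ∑ h ∈ Finset.range (M₂ + 1), ρ₂ h = 1)
    (hR₂ : ∑ h ∈ Finset.range (M₂ + 1), (h : ℝ) * ρ₂ h = R₂) (hta₂ : y₂ * (M₂ : ℝ) ≤ R₂) (hR₂0 : 0 < R₂)
    (h₃0 : ∀ h, 0 ≤ ρ₃ h) (h₃M : ∀ h, M₃ < h → ρ₃ h = 0) (h₃1 : ∑ h ∈ Finset.range (M₃ + 1), ρ₃ h = 1)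
    (hR₃ : ∑ h ∈ Finset.range (M₃ + 1), (h : ℝ) * ρ₃ h = R₃) (hta₃ : y₃ * (M₃ : ℝ) ≤ R₃)
    (hD₁ : SDEC y₁ M₁ ρ₁) (hD₂ : SDEC y₂ M₂ ρ₂) (hD₃ : SDEC y₃ M₃ ρ₃)
    (hl₂ : l₂ = q₂ * (R₂ - (1 - q₁) * R₁) / (Q * R₂)) (hl₁ : l₁ = q₁ * (R₁ - (1 - q₂) * R₂) / (Q * R₁))
    (hl₂R : (1 - q₁) * R₁ ≤ R₂) (hl₁R : (1 - q₂) * R₂ ≤ R₁)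
    (hG₁₂ : SDEC w₁₂ (M₁ + M₂) (lconv M₁ M₂ ρ₁ (gate ρ₂ (q₂ / q₁))))
    (htaG₁₂ : w₁₂ * ((M₁ + M₂ : ℕ) : ℝ) ≤ R₁ + q₂ / q₁ * R₂)
    (hG₁ : SDEC v₁ (M₁ + M₂ + M₃) (lconv (M₁ + M₂) M₃ (lconv M₁ M₂ ρ₁ (gate ρ₂ l₂)) (gate ρ₃ (q₃ / Q))))
    (hG₂ : SDEC v₂ (M₁ + M₂ + M₃) (lconv (M₁ + M₂) M₃ (lconv M₁ M₂ (gate ρ₁ l₁) ρ₂) (gate ρ₃ (q₃ / Q))))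
    (hx₁ : x ≤ q₁ * y₁) (hx₂ : x ≤ q₂ * y₂) (hx₃ : x ≤ q₃ * y₃) (hx₁₂ : x ≤ q₁ * w₁₂) (hxv₁ : x ≤ Q * v₁) (hxv₂ : x ≤ Q * v₂) :
    SDEC x (M₁ + M₂ + M₃) (lconv (M₁ + M₂) M₃ (lconv M₁ M₂ (gate ρ₁ q₁) (gate ρ₂ q₂)) (gate ρ₃ q₃)) := by
  intro a ha0 ha1 j hj
  have b₁ := mul_le_mul_of_nonneg_left hx₁ ha0.le
  have b₂ := mul_le_mul_of_nonneg_left hx₂ ha0.le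
  have b₃ := mul_le_mul_of_nonneg_left hx₃ ha0.le
  have b₁₂ := mul_le_mul_of_nonneg_left hx₁₂ ha0.le
  have bv₁ := mul_le_mul_of_nonneg_left hxv₁ ha0.le
  have bv₂ := mul_le_mul_of_nonneg_left hxv₂ ha0.le
  exact decAt_threeRootGeneric_of_opened y₁ y₂ y₃ w₁₂ v₁ v₂ (a * x) q₁ q₂ q₃ a Q R₁ R₂ R₃ l₁ l₂ M₁ M₂ M₃ ρ₁ ρ₂ ρ₃
    hy₁0 hy₁1 hy₂0 hy₂1 hy₃0 hy₃1 hw0 hw1 hv₁0 hv₁1 hv₂0 hv₂1 hq₂0 hq₂₁ hq₁1 hq₃0 hq₃1 hQ hq₃Q ha0 ha1 (mul_pos ha0 hx0)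
    h₁0 h₁M h₁1 hR₁ hta₁ hR₁0 h₂0 h₂M h₂1 hR₂ hta₂ hR₂0 h₃0 h₃M h₃1 hR₃ hta₃ hD₁ hD₂ hD₃ hl₂ hl₁ hl₂R hl₁R hG₁₂ htaG₁₂ hG₁ hG₂
    (by linarith) (by linarith) (by linarith) (by linarith) (by linarith) (by linarith) j hj

end LawDec

end Quant

end Summit.CriticalPhenomena.PercolationContinuityZ3.Theorems
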